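import Mathlib
import HarnessLib
import Literature.NumberTheory.LFunctions.ZetaScrew
import Literature.NumberTheory.LFunctions.ZetaScrewThm41Proofs
import Literature.NumberTheory.LFunctions.ZetaScrewThm42Proofs
import Summits.RiemannHypothesis.RiemannHypothesis.Theorems.IntegerScrewDefs
import Summits.RiemannHypothesis.RiemannHypothesis.Theorems.IntegerScrewHingeCarrier
import Summits.RiemannHypothesis.RiemannHypothesis.Theorems.IntegerScrewPivotCriterion
import Summits.RiemannHypothesis.RiemannHypothesis.Theorems.IntegerScrewHingeSplitAtoms

/-!
# Route `IntegerScrew` — the HINGE SPLIT of the screw matrices, II: `S_M = P⁺_M − P⁻_M` with both parts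
# positive semidefinite (SCREW column, rung S-P (P3) «prime-side structured decomposition»; RH-FREE identity)

Writing the prime sum of Suzuki2023 (1.1) with hinges, `(t − log q)_+ = t − min(t, log q)` for
`0 ≤ t ≤ log M` (`primeSum_eq_hinge`), Suzuki's screw matrix `S_M = screwMatrix (M − 1)` becomes the
difference of two explicit positive semidefinite matrices (`screwMatrix_eq_hingePos_sub_hingeNeg`):

`S_M = P⁺_M − P⁻_M`,  `P⁺_M = 8ssᵀ + G_F + Σ_{q ≤ M} Λ(q)q^{−1/2}·G_{min(·,log q)}`,
                      `P⁻_M = 8ccᵀ + (A + 2Σ_{q ≤ M}Λ(q)q^{−1/2})·MIN`,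

`s_m = sinh(log m /2)`, `c_m = cosh(log m /2) − 1` (polar part `8(cosh(u/2) − 1)`), `G_F` = the Kreĭn–Gram
matrix of the Hurwitz–Lerch part `F = wallF = Σ_k (1 − e^{−λ_k|u|})/λ_k²` (`λ_k = 2k + ½`) = `Σ_k ouGram λ_k/λ_k²`
(`lerchGram`, an OU mixture), `G_{min(·,log q)} = boxGram q` the boxcar atoms, `MIN = minGram = [min(log a, log b)]`
the Brownian part, `A = wallSlope = γ₀ + π/2 + 3 log 2 + log π`.  By file I (`IntegerScrewHingeSplitAtoms`) and
`lerchGram_posSemidef` every piece is a nonnegative (countable) combination of INTEGER-INDEXED rank-one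
projectors, so `P⁺_M ⪰ 0` and `P⁻_M ⪰ 0` (`hingePos_posSemidef`, `hingeNeg_posSemidef`): the literal
«Toeplitz-in-log» structured SOS `S_M = JᵀJ − P⁻_M` whose remainder `−P⁻_M` is ONE-SIGNED (negative
semidefinite) — of the wrong sign for a certificate.

Consequences recorded: `screwMatrix_posSemidef_iff_hinge` (`S_M ⪰ 0 ↔ vᵀP⁻_Mv ≤ vᵀP⁺_Mv ∀v`) and, through the
tree's `riemannHypothesis_iff_screwMatrix_posSemidef`, `riemannHypothesis_iff_hingeNeg_le_hingePos`.

LABELS (LADDER-RH §5 rule 4).  The identity and the two positivity statements are RH-FREE (elementary; no zeros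
of `ζ`).  The `∀ M` sentence `P⁻_M ≤ P⁺_M` is RH-EQUIVALENT — it IS `∀ M, S_M ⪰ 0`, i.e. Weil's explicit
formula positivity at window `log M` re-indexed (tautology test: YES, by construction) — and is NOT claimed;
per `M` it is an RH-consequence (kernel-proved in the tree for `M ≤ 256`, `IntegerScrewRung*`).  The rh-explicit
SOS census (HOME/sos/D4-TOEPLITZLOG-STRUCTURED-SOS-eng3.md) measured the cancellation in this normal form:
`min_v vᵀS_Mv / vᵀP⁺_Mv ≈ 0.3·M^{−5/2}` for `M ≤ 256`.  Nothing here bears on the truth of RH.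
References: M. Suzuki, J. Lond. Math. Soc. (2) 108 (2023) 1448–1487 = arXiv:2206.03682, (1.1), (1.4), Thm 1.2
[Suzuki2023].
-/

noncomputable section

-- D-0017: `Summit.<S>.<S>.…` is the designed namespace of a single-problem summit.
set_option linter.dupNamespace false

namespace Summit.RiemannHypothesis.RiemannHypothesis.Theorems.IntegerScrew

namespace HingeSplit

open Literature.NumberTheory.LFunctions Literature.NumberTheory.LFunctions.Suzuki2023Thm41 Finset Matrix

variable {n : ℕ}

/-! ### The Hurwitz–Lerch part `[F(x) + F(y) − F(|x − y|)]`, `F = wallF = Σ_k (1 − e^{−λ_k t})/λ_k²` -/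

/-- `λ_k ≥ 0`. [folklore] -/
theorem lam_nonneg (k : ℕ) : 0 ≤ lam k := by unfold lam; positivity

/-- `λ_k² = (2k + ½)²` matches `Suzuki2023Thm42.summable_one_div_lam_sq`. [folklore] -/
theorem summable_one_div_lam_sq' : Summable fun k : ℕ => 1 / lam k ^ 2 := by
  simpa [lam] using Suzuki2023Thm42.summable_one_div_lam_sq

/-- The terms `(1 − e^{−λ_k t})/λ_k²` of `wallF t` are summable for `t ≥ 0`. [folklore] -/
theorem summable_wallF_term {t : ℝ} (ht : 0 ≤ t) :
    Summable fun k : ℕ => (1 - Real.exp (-(lam k * t))) / lam k ^ 2 := by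
  refine summable_one_div_lam_sq'.of_norm_bounded fun k => ?_
  have h1 : Real.exp (-(lam k * t)) ≤ 1 :=
    Real.exp_le_one_iff.2 (by have := lam_nonneg k; nlinarith)
  have h2 := Real.exp_pos (-(lam k * t))
  rw [Real.norm_eq_abs, abs_div, abs_of_nonneg (sub_nonneg.2 h1), abs_of_nonneg (sq_nonneg _)]
  exact div_le_div_of_nonneg_right (by linarith) (sq_nonneg _)

/-- The terms `E_{λ_k}(x_i, x_j)/λ_k²` are summable. [folklore] -/
theorem summable_ouKernel_div (i j : Fin n) :
    Summable fun k : ℕ => ouKernel (lam k) (xl i) (xl j) / lam k ^ 2 := by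
  refine (summable_one_div_lam_sq'.mul_left 2).of_norm_bounded fun k => ?_
  rw [Real.norm_eq_abs, abs_div, abs_of_nonneg (sq_nonneg (lam k)), mul_one_div]
  exact div_le_div_of_nonneg_right (abs_ouKernel_le (lam_nonneg k) (xl_nonneg i) (xl_nonneg j))
    (sq_nonneg _)

/-- `lerchGram n = Σ_k ouGram n λ_k / λ_k²` (entrywise series). [folklore] -/
def lerchGram (n : ℕ) : Matrix (Fin n) (Fin n) ℝ :=
  of fun i j => ∑' k : ℕ, ouGram n (lam k) i j / lam k ^ 2

/-- The Lerch entry formula: `lerchGram n i j = F(x_i) + F(x_j) − F(|x_i − x_j|)`, `F = wallF`. [folklore] -/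
theorem lerchGram_apply (i j : Fin n) :
    lerchGram n i j = wallF (xl i) + wallF (xl j) - wallF |xl i - xl j| := by
  rw [lerchGram, of_apply, wallF, wallF, wallF]
  simp_rw [ouGram_apply]
  rw [← (summable_wallF_term (xl_nonneg i)).tsum_add (summable_wallF_term (xl_nonneg j)),
    ← ((summable_wallF_term (xl_nonneg i)).add (summable_wallF_term (xl_nonneg j))).tsum_sub
      (summable_wallF_term (abs_nonneg _))]
  refine tsum_congr fun k => ?_
  rw [ouKernel]; ring

/-- `lerchGram n` is symmetric. [folklore] -/
theorem lerchGram_isHermitian (n : ℕ) : (lerchGram n).IsHermitian := by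
  refine Matrix.IsHermitian.ext fun i j => ?_
  rw [star_trivial, lerchGram_apply, lerchGram_apply, abs_sub_comm]; ring

/-- The quadratic form of an entrywise-summable series of matrices is the series of the quadratic
forms. [folklore] -/
theorem dotProduct_mulVec_of_tsum (B : ℕ → Matrix (Fin n) (Fin n) ℝ)
    (hB : ∀ i j, Summable fun k => B k i j) (v : Fin n → ℝ) :
    v ⬝ᵥ ((of fun i j => ∑' k, B k i j) *ᵥ v) = ∑' k, v ⬝ᵥ (B k *ᵥ v) := by
  simp only [dotProduct, mulVec, of_apply]
  have h1 : ∀ i j, v i * ((∑' k, B k i j) * v j) = ∑' k, v i * (B k i j * v j) := by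
    intro i j; rw [← tsum_mul_right, ← tsum_mul_left]
  have hs1 : ∀ i j, Summable fun k => v i * (B k i j * v j) := fun i j =>
    ((hB i j).mul_right (v j)).mul_left (v i)
  simp_rw [Finset.mul_sum, h1]
  have h2 : ∀ i, ∑ j, ∑' k, v i * (B k i j * v j) = ∑' k, ∑ j, v i * (B k i j * v j) := fun i =>
    (Summable.tsum_finsetSum fun j _ => hs1 i j).symm
  simp_rw [h2]
  exact (Summable.tsum_finsetSum fun i _ => summable_sum fun j _ => hs1 i j).symm

/-- `lerchGram n ⪰ 0`: its quadratic form is `Σ_k λ_k^{−2}·(vᵀ ouGram n λ_k v) ≥ 0`. [folklore] -/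
theorem lerchGram_posSemidef (n : ℕ) : (lerchGram n).PosSemidef := by
  refine PosSemidef.of_dotProduct_mulVec_nonneg (lerchGram_isHermitian n) fun v => ?_
  rw [star_trivial]
  have hB : ∀ i j : Fin n, Summable fun k : ℕ => ((1 / lam k ^ 2) • ouGram n (lam k)) i j := by
    intro i j
    simp_rw [Matrix.smul_apply, smul_eq_mul, ouGram_apply, one_div, inv_mul_eq_div]
    exact summable_ouKernel_div i j
  have hrw : lerchGram n = of fun i j => ∑' k : ℕ, ((1 / lam k ^ 2) • ouGram n (lam k)) i j := by
    ext i j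
    simp only [lerchGram, of_apply, Matrix.smul_apply, smul_eq_mul, one_div, inv_mul_eq_div]
  rw [hrw, dotProduct_mulVec_of_tsum _ hB]
  refine tsum_nonneg fun k => ?_
  rw [Matrix.smul_mulVec, dotProduct_smul, smul_eq_mul]
  exact mul_nonneg (by positivity)
    (by simpa using (ouGram_posSemidef n (lam_nonneg k)).dotProduct_mulVec_nonneg v)

/-! ### The polar rays and the two hinge parts -/

/-- `s(m) = sinh(log m / 2)`. [folklore] -/
def sVec (n : ℕ) : Fin n → ℝ := fun i => Real.sinh (xl i / 2)

/-- `c(m) = cosh(log m / 2) − 1`. [folklore] -/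
def cVec (n : ℕ) : Fin n → ℝ := fun i => Real.cosh (xl i / 2) - 1

/-- `ψ̃_{n+1} = Σ_{q ≤ n+1} Λ(q)/√q`, the total weight of the boxcar atoms. [folklore] -/
def primeWeightSum (n : ℕ) : ℝ :=
  ∑ q ∈ Icc 1 (n + 1), ArithmeticFunction.vonMangoldt q / Real.sqrt q

/-- `Λ(q)/√q ≥ 0`. [folklore] -/
theorem vonMangoldt_div_sqrt_nonneg (q : ℕ) : 0 ≤ ArithmeticFunction.vonMangoldt q / Real.sqrt q :=
  div_nonneg ArithmeticFunction.vonMangoldt_nonneg (Real.sqrt_nonneg _)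

/-- `ψ̃ ≥ 0`. [folklore] -/
theorem primeWeightSum_nonneg (n : ℕ) : 0 ≤ primeWeightSum n :=
  Finset.sum_nonneg fun q _ => vonMangoldt_div_sqrt_nonneg q

/-- `A = γ₀ + π/2 + 3 log 2 + log π > 0`. [folklore] -/
theorem wallSlope_pos : 0 < wallSlope := by
  unfold wallSlope
  have h1 := Real.one_half_lt_eulerMascheroniConstant
  have h2 : 0 < Real.log 2 := Real.log_pos (by norm_num)
  have h3 : 0 < Real.log Real.pi := Real.log_pos (by linarith [Real.pi_gt_three])
  positivity

/-- THE POSITIVE HINGE PART `P⁺ = 8ssᵀ + lerchGram + Σ_{q ≤ n+1} Λ(q)q^{−1/2}·boxGram q` — polar ray, the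
Hurwitz–Lerch (OU-mixture) Gram and the prime-weighted boxcar Grams of widths `log q`. [folklore] -/
def hingePos (n : ℕ) : Matrix (Fin n) (Fin n) ℝ :=
  (8 : ℝ) • vecMulVec (sVec n) (sVec n) + lerchGram n +
    ∑ q ∈ Icc 1 (n + 1), (ArithmeticFunction.vonMangoldt q / Real.sqrt q) • boxGram n q

/-- THE NEGATIVE HINGE PART `P⁻ = 8ccᵀ + (A + 2ψ̃)·minGram` — polar ray and the Brownian Gram with the
total slope `A + 2Σ_{q ≤ n+1}Λ(q)/√q`. [folklore] -/
def hingeNeg (n : ℕ) : Matrix (Fin n) (Fin n) ℝ :=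
  (8 : ℝ) • vecMulVec (cVec n) (cVec n) + (wallSlope + 2 * primeWeightSum n) • minGram n

/-- `P⁺ ⪰ 0`. [folklore] -/
theorem hingePos_posSemidef (n : ℕ) : (hingePos n).PosSemidef :=
  (((posSemidef_vecMulVec_self _).smul (by norm_num)).add (lerchGram_posSemidef n)).add
    (posSemidef_sum _ fun q _ => (boxGram_posSemidef n q).smul (vonMangoldt_div_sqrt_nonneg q))

/-- `P⁻ ⪰ 0`. [folklore] -/
theorem hingeNeg_posSemidef (n : ℕ) : (hingeNeg n).PosSemidef :=
  ((posSemidef_vecMulVec_self _).smul (by norm_num)).add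
    ((minGram_posSemidef n).smul (by have := wallSlope_pos; have := primeWeightSum_nonneg n; positivity))

/-! ### The hinge form of the prime sum and the node bounds -/

/-- HINGE FORM of Suzuki's prime sum: for `0 ≤ t` with `e^t ≤ n + 1`,
`φ(t) = Σ_{q ≤ n+1} Λ(q)q^{−1/2}·(t − min(t, log q))` (the hinge `(t − log q)_+ = t − min(t, log q)`;
the terms `q > e^t` vanish). [cite: Suzuki2023, (1.1)] -/
theorem primeSum_eq_hinge {t : ℝ} (ht : 0 ≤ t) (hM : Real.exp t ≤ ((n + 1 : ℕ) : ℝ)) :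
    zetaScrewPrimeSum t = ∑ q ∈ Icc 1 (n + 1),
      ArithmeticFunction.vonMangoldt q / Real.sqrt q * (t - min t (Real.log q)) := by
  have habs : |t| = t := abs_of_nonneg ht
  rw [zetaScrewPrimeSum_eq_sum_max (M := n + 1) (by rwa [habs]), habs]
  refine Finset.sum_congr rfl fun q _ => ?_
  congr 1
  rcases le_total t (Real.log q) with h | h
  · rw [min_eq_left h, max_eq_right (by linarith), sub_self]
  · rw [min_eq_right h, max_eq_left (by linarith)]

/-- `e^{x_i} = nd i ≤ n + 1`. [folklore] -/
theorem exp_xl_le (i : Fin n) : Real.exp (xl i) ≤ ((n + 1 : ℕ) : ℝ) := by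
  rw [xl, Real.exp_log (nd_pos i)]
  exact_mod_cast nd_le i

/-- `e^{|x_i − x_j|} ≤ n + 1`. [folklore] -/
theorem exp_abs_xl_sub_le (i j : Fin n) : Real.exp |xl i - xl j| ≤ ((n + 1 : ℕ) : ℝ) := by
  have hi := xl_nonneg i; have hj := xl_nonneg j
  rcases le_total (xl i) (xl j) with h | h
  · rw [abs_of_nonpos (sub_nonpos.2 h)]
    exact (Real.exp_le_exp.2 (by linarith)).trans (exp_xl_le j)
  · rw [abs_of_nonneg (sub_nonneg.2 h)]
    exact (Real.exp_le_exp.2 (by linarith)).trans (exp_xl_le i)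

/-- `Ψ` at an admissible argument: `Ψ(t) = 8(cosh(t/2) − 1) − (A/2)t + F(t) − Σ_q Λ(q)q^{−1/2}(t − min(t, log q))`
for `0 ≤ t`, `e^t ≤ n + 1`. [cite: Suzuki2023, (1.1)] -/
theorem zetaScrew_eq_hinge {t : ℝ} (ht : 0 ≤ t) (hM : Real.exp t ≤ ((n + 1 : ℕ) : ℝ)) :
    zetaScrew t = 8 * (Real.cosh (t / 2) - 1) - wallSlope / 2 * t + wallF t
      - ∑ q ∈ Icc 1 (n + 1), ArithmeticFunction.vonMangoldt q / Real.sqrt q * (t - min t (Real.log q)) := by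
  rw [zetaScrew_eq_wallPsi_sub_primeSum ht, primeSum_eq_hinge ht hM, wallPsi]

/-! ### The hinge split -/

/-- Entries of the structured side. [folklore] -/
theorem hingePos_sub_hingeNeg_apply (i j : Fin n) :
    (hingePos n - hingeNeg n) i j =
      8 * (Real.sinh (xl i / 2) * Real.sinh (xl j / 2))
      + (wallF (xl i) + wallF (xl j) - wallF |xl i - xl j|)
      + ∑ q ∈ Icc 1 (n + 1), ArithmeticFunction.vonMangoldt q / Real.sqrt q *
          (min (xl i) (Real.log q) + min (xl j) (Real.log q) - min |xl i - xl j| (Real.log q))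
      - (8 * ((Real.cosh (xl i / 2) - 1) * (Real.cosh (xl j / 2) - 1))
         + (wallSlope + 2 * primeWeightSum n) * min (xl i) (xl j)) := by
  simp only [hingePos, hingeNeg, Matrix.sub_apply, Matrix.add_apply, Matrix.smul_apply, Matrix.sum_apply,
    vecMulVec_apply, smul_eq_mul, lerchGram_apply, minGram_apply, sVec, cVec]
  congr 2
  refine Finset.sum_congr rfl fun q hq => ?_
  rw [boxGram_apply (Finset.mem_Icc.1 hq).1]

/-- **THE HINGE SPLIT OF THE SCREW MATRICES (Toeplitz-in-log normal form I1).**  For every `n`,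
`screwMatrix n = hingePos n − hingeNeg n`, i.e. for `S_M` (`M = n + 1`, nodes `2 ≤ a, b ≤ M`):

`S_M = [8ssᵀ + G_F + Σ_{q ≤ M} Λ(q)q^{−1/2}·G_{min(·, log q)}] − [8ccᵀ + (A + 2Σ_{q ≤ M}Λ(q)q^{−1/2})·MIN]`,

`s_m = sinh(log m /2)`, `c_m = cosh(log m /2) − 1`, `G_F` the Hurwitz–Lerch (OU-mixture) Gram, `G_{min(·,log q)}`
the boxcar Gram of width `log q`, `MIN = [min(log a, log b)]`, `A = γ₀ + π/2 + 3 log 2 + log π` — BOTH brackets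
positive semidefinite (`hingePos_posSemidef`, `hingeNeg_posSemidef`) and each a nonnegative (countable)
combination of integer-indexed rank-one projectors.  RH-FREE identity (Weil's explicit formula at window
`log M`, prime side written with hinges); nothing here bears on the truth of RH. [cite: Suzuki2023, (1.1), (1.4)] -/
theorem screwMatrix_eq_hingePos_sub_hingeNeg (n : ℕ) : screwMatrix n = hingePos n - hingeNeg n := by
  ext i j
  rw [hingePos_sub_hingeNeg_apply, screwMatrix_apply, zetaScrewKernel_def, ← zetaScrew_abs (xl i - xl j),
    zetaScrew_eq_hinge (xl_nonneg i) (exp_xl_le i), zetaScrew_eq_hinge (xl_nonneg j) (exp_xl_le j),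
    zetaScrew_eq_hinge (abs_nonneg _) (exp_abs_xl_sub_le i j)]
  -- the polar identity and `x + y − |x − y| = 2 min(x, y)`
  have hcosh : Real.cosh (|xl i - xl j| / 2) =
      Real.cosh (xl i / 2) * Real.cosh (xl j / 2) - Real.sinh (xl i / 2) * Real.sinh (xl j / 2) := by
    rw [show |xl i - xl j| / 2 = |xl i / 2 - xl j / 2| by
      rw [← sub_div, abs_div, abs_of_pos (by norm_num : (0:ℝ) < 2)], Real.cosh_abs, Real.cosh_sub]
  have hmin : xl i + xl j - |xl i - xl j| = 2 * min (xl i) (xl j) := by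
    rw [← max_sub_min_eq_abs' (xl i) (xl j)]; linarith [min_add_max (xl i) (xl j)]
  -- the prime sums
  set c : ℕ → ℝ := fun q => ArithmeticFunction.vonMangoldt q / Real.sqrt q with hc
  have hsum : ∑ q ∈ Icc 1 (n + 1), c q * (xl i - min (xl i) (Real.log q))
      + ∑ q ∈ Icc 1 (n + 1), c q * (xl j - min (xl j) (Real.log q))
      - ∑ q ∈ Icc 1 (n + 1), c q * (|xl i - xl j| - min |xl i - xl j| (Real.log q))
      = 2 * min (xl i) (xl j) * primeWeightSum n
        - ∑ q ∈ Icc 1 (n + 1), c q * (min (xl i) (Real.log q) + min (xl j) (Real.log q)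
            - min |xl i - xl j| (Real.log q)) := by
    rw [primeWeightSum, Finset.mul_sum, ← Finset.sum_add_distrib, ← Finset.sum_sub_distrib,
      ← Finset.sum_sub_distrib]
    refine Finset.sum_congr rfl fun q _ => ?_
    rw [← hmin]; simp only [hc]; ring
  rw [hcosh]
  linear_combination (-1 : ℝ) * hsum + (-(wallSlope / 2)) * hmin

/-- The hinge split as a STRUCTURED SOS WITH A ONE-SIGNED REMAINDER: `S_M + P⁻_M = P⁺_M` with `P⁻_M ⪰ 0`,
i.e. `S_M = P⁺_M − P⁻_M = JᵀJ + R` with `R = −P⁻_M` negative semidefinite (the remainder's sign law of the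
Toeplitz-in-log ansatz; RH-FREE). [folklore] -/
theorem screwMatrix_add_hingeNeg (n : ℕ) : screwMatrix n + hingeNeg n = hingePos n := by
  rw [screwMatrix_eq_hingePos_sub_hingeNeg, sub_add_cancel]

/-- The normal form read as a positivity statement: `S_M ⪰ 0 ↔ P⁻_M ≤ P⁺_M` as quadratic forms
(`vᵀ hingeNeg v ≤ vᵀ hingePos v` for all real `v`).  Per `M` this is an RH-CONSEQUENCE (kernel-proved in the
tree for `M ≤ 256`); as an `∀ M` sentence it is RH-EQUIVALENT (next theorem) — NOT claimed. [folklore] -/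
theorem screwMatrix_posSemidef_iff_hinge (n : ℕ) :
    (screwMatrix n).PosSemidef ↔ ∀ v : Fin n → ℝ, v ⬝ᵥ (hingeNeg n *ᵥ v) ≤ v ⬝ᵥ (hingePos n *ᵥ v) := by
  rw [posSemidef_iff_dotProduct_mulVec, screwMatrix_eq_hingePos_sub_hingeNeg]
  have hH : (hingePos n - hingeNeg n).IsHermitian :=
    (hingePos_posSemidef n).isHermitian.sub (hingeNeg_posSemidef n).isHermitian
  simp only [hH, true_and, star_trivial, sub_mulVec, dotProduct_sub, sub_nonneg]


/-! ### Blocks of ratio `< 2`: the prime part is a rank-two diagonal field -/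

/-- On a pair of nodes with `max(a,b) < 2·min(a,b)` one has `|log a − log b| < log 2`. [folklore] -/
theorem abs_xl_sub_lt_log_two {i j : Fin n} (h : max (nd i) (nd j) < 2 * min (nd i) (nd j)) :
    |xl i - xl j| < Real.log 2 := by
  rw [xl, xl, abs_log_sub_log]
  have hmn : (0 : ℝ) < (min (nd i) (nd j) : ℕ) := by
    have := two_le_nd i; have := two_le_nd j
    exact_mod_cast (show 0 < min (nd i) (nd j) from lt_min (by omega) (by omega))
  have hlt : Real.log ((max (nd i) (nd j) : ℕ) : ℝ) < Real.log ((2 * min (nd i) (nd j) : ℕ) : ℝ) :=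
    Real.log_lt_log (by have := two_le_nd i; exact_mod_cast (show 0 < max (nd i) (nd j) from
      lt_max_of_lt_left (by omega))) (by exact_mod_cast h)
  rw [Nat.cast_mul, Nat.cast_two, Real.log_mul two_ne_zero hmn.ne'] at hlt
  linarith

/-- **BLOCKS OF RATIO `< 2` ARE PRIME-FREE UP TO A RANK-TWO FIELD.**  If `max(a,b) < 2·min(a,b)` then the
prime part of the hinge split collapses at `(a, b)`:
`Σ_q Λ(q)q^{−1/2}·boxGram q [a,b] − 2ψ̃·min(log a, log b) = −(φ(log a) + φ(log b))`, `φ = zetaScrewPrimeSum`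
(every boxcar of width `log q ≥ log 2` sees the pair at distance `|log a − log b| < log 2` through its linear
part only).  So on the top dyadic block `(M/2, M]` all off-diagonal ARITHMETIC structure of `S_M` is the
diagonal field `m ↦ −φ(log m)`; the rest is polar + Hurwitz–Lerch + Brownian (next theorem).  RH-FREE.
[folklore] -/
theorem primePart_apply_of_lt_two_mul {i j : Fin n} (h : max (nd i) (nd j) < 2 * min (nd i) (nd j)) :
    ∑ q ∈ Icc 1 (n + 1), ArithmeticFunction.vonMangoldt q / Real.sqrt q * boxGram n q i j
        - 2 * primeWeightSum n * min (xl i) (xl j)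
      = -(zetaScrewPrimeSum (xl i) + zetaScrewPrimeSum (xl j)) := by
  have hlt := abs_xl_sub_lt_log_two h
  have hmin : xl i + xl j - |xl i - xl j| = 2 * min (xl i) (xl j) := by
    rw [← max_sub_min_eq_abs' (xl i) (xl j)]; linarith [min_add_max (xl i) (xl j)]
  -- each weighted boxcar entry is linear in |x − y|
  have hbox : ∀ q ∈ Icc 1 (n + 1), ArithmeticFunction.vonMangoldt q / Real.sqrt q * boxGram n q i j =
      ArithmeticFunction.vonMangoldt q / Real.sqrt q *
        (min (xl i) (Real.log q) + min (xl j) (Real.log q)) -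
      ArithmeticFunction.vonMangoldt q / Real.sqrt q * |xl i - xl j| := by
    intro q hq
    have hq1 := (Finset.mem_Icc.1 hq).1
    rcases Nat.eq_or_lt_of_le hq1 with hq | hq
    · subst hq; simp
    · rw [boxGram_apply hq1, min_eq_left (hlt.le.trans (Real.log_le_log (by norm_num)
        (by exact_mod_cast hq)))]
      ring
  rw [Finset.sum_congr rfl hbox, Finset.sum_sub_distrib, ← Finset.sum_mul,
    primeSum_eq_hinge (xl_nonneg i) (exp_xl_le i), primeSum_eq_hinge (xl_nonneg j) (exp_xl_le j),
    ← primeWeightSum]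
  have hsplit : ∑ q ∈ Icc 1 (n + 1), ArithmeticFunction.vonMangoldt q / Real.sqrt q *
        (min (xl i) (Real.log q) + min (xl j) (Real.log q))
      = (xl i + xl j) * primeWeightSum n
        - (∑ q ∈ Icc 1 (n + 1), ArithmeticFunction.vonMangoldt q / Real.sqrt q * (xl i - min (xl i) (Real.log q))
          + ∑ q ∈ Icc 1 (n + 1), ArithmeticFunction.vonMangoldt q / Real.sqrt q *
              (xl j - min (xl j) (Real.log q))) := by
    rw [primeWeightSum, Finset.mul_sum, ← Finset.sum_add_distrib, ← Finset.sum_sub_distrib]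
    refine Finset.sum_congr rfl fun q _ => ?_
    ring
  rw [hsplit]
  linear_combination primeWeightSum n * hmin

/-- The screw matrix on a block of ratio `< 2`: `S_M[a,b] = 8(s_a s_b − c_a c_b) + G_F[a,b] − A·min(log a, log b)
− φ(log a) − φ(log b)` — polar + Hurwitz–Lerch + Brownian + a diagonal prime field (`Ψ` is prime-free below
`log 2`).  RH-FREE. [folklore] -/
theorem screwMatrix_apply_of_lt_two_mul {i j : Fin n} (h : max (nd i) (nd j) < 2 * min (nd i) (nd j)) :
    screwMatrix n i j = 8 * (Real.sinh (xl i / 2) * Real.sinh (xl j / 2))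
      - 8 * ((Real.cosh (xl i / 2) - 1) * (Real.cosh (xl j / 2) - 1))
      + lerchGram n i j - wallSlope * min (xl i) (xl j)
      - (zetaScrewPrimeSum (xl i) + zetaScrewPrimeSum (xl j)) := by
  have hP := primePart_apply_of_lt_two_mul h
  rw [Finset.sum_congr rfl fun q hq => by rw [boxGram_apply (Finset.mem_Icc.1 hq).1]] at hP
  rw [screwMatrix_eq_hingePos_sub_hingeNeg, hingePos_sub_hingeNeg_apply, ← lerchGram_apply]
  linear_combination hP

/-- **`RH ↔ P⁻_M ≤ P⁺_M` (as quadratic forms) for every `M`** — the hinge normal form of the criterion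
`RH ↔ ∀ M, S_M ⪰ 0` (`riemannHypothesis_iff_screwMatrix_posSemidef`, Suzuki2023 Thm 1.2 on the integer
nodes + the route's RH-free detection).  LABEL: RH-EQUIVALENT — a restatement of the criterion in the
coordinates of this file, NOT progress toward RH and not claimed in either direction. [cite: Suzuki2023, Thm 1.2] -/
theorem riemannHypothesis_iff_hingeNeg_le_hingePos :
    _root_.RiemannHypothesis ↔
      ∀ n : ℕ, ∀ v : Fin n → ℝ, v ⬝ᵥ (hingeNeg n *ᵥ v) ≤ v ⬝ᵥ (hingePos n *ᵥ v) := by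
  rw [riemannHypothesis_iff_screwMatrix_posSemidef]
  exact forall_congr' fun n => screwMatrix_posSemidef_iff_hinge n

end HingeSplit

end Summit.RiemannHypothesis.RiemannHypothesis.Theorems.IntegerScrew
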